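import Summits.NavierStokesRegularity.NavierStokesRegularity.Theses.QuantisedSymmetry
import Literature.Analysis.FluidPDE.SelfSimilar
import HarnessLib

/-!
# Route `QuantisedSymmetry`, support item `LiouvilleKillsProfile` (stmt-NavierStokesRegularity-1408)

`PolyhedralTypeILiouville → ¬ PolyhedralDssProfileExists`: the polyhedral (T/O/I) Type-I Liouville
theorem is the exact kill switch of the polyhedral discretely self-similar profile.

Proof (Koch–Nadirashvili–Seregin–Šverák 2009, §1: translation and scaling invariance of the class
of ancient mild solutions). Given the profile `u` (`λ`-DSS, Type-I decay `C₀`, `G`-equivariant,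
ancient mild with measurable slices), the time shift `ũ t := u (t - 1)` is again ancient mild
(`IsAncientMildSolution.time_translate`), bounded by `C₀` on `(-∞, 0)` (`‖u (t-1) x‖ ≤ C₀/√(1-t) ≤ C₀`),
has measurable slices, Type-I decay with the same constant (`√(1-t) ≥ √(-t)`) and the same
`G`-equivariance; the Liouville hypothesis gives `ũ t = 0` a.e. for every `t < 0`, i.e. `u s = 0`
a.e. for `s < -1`. Discrete self-similarity `u = nsRescale (λ^k) u` (`u t x = λ^k u(λ^{2k} t, λ^k x)`,
pick `k` with `λ^{2k} t < -1`) and quasi-measure-preservation of the dilation `x ↦ λ^k x`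
(Mathlib `Measure.quasiMeasurePreserving_smul`) spread this to every `t < 0`, contradicting the
nontriviality clause of the profile.
-/

-- the summit namespace `…NavierStokesRegularity.NavierStokesRegularity…` is the tree convention (D-0017)
set_option linter.dupNamespace false

namespace Summit.NavierStokesRegularity.NavierStokesRegularity.Theorems

open MeasureTheory Set Filter
open Literature.Analysis.FluidPDE

/-- A `λ`-DSS field is `λ^m`-DSS for every `m : ℕ` (iterate the group law
`IsDiscretelySelfSimilar.mul`; Bradshaw–Tsai 2019, §3). [folklore] -/
theorem quantisedSymmetry_isDiscretelySelfSimilar_pow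
    {E F : Type*} [NormedAddCommGroup E] [NormedSpace ℝ E] [NormedAddCommGroup F] [NormedSpace ℝ F]
    {c : ℝ} {u : ℝ → E → F} (h : IsDiscretelySelfSimilar c u) (m : ℕ) :
    IsDiscretelySelfSimilar (c ^ m) u := by
  induction m with
  | zero => rw [pow_zero]; exact nsRescale_one u
  | succ m ih => rw [pow_succ]; exact ih.mul h

/-- **DSS spreading of a.e. vanishing.** If `u` is `λ`-discretely self-similar with `1 < λ` and its
slices vanish a.e. for all times `s < T` (any real `T`), then every slice `u t`, `t < 0`, vanishes
a.e.: `u t x = λ^k u(λ^{2k} t, λ^k x)` with `λ^{2k} t < T`, and the dilation `x ↦ λ^k x` is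
quasi-measure-preserving for Lebesgue measure. [folklore] -/
theorem quantisedSymmetry_ae_zero_of_dss {c : ℝ} (hc : 1 < c)
    {u : ℝ → EuclideanSpace ℝ (Fin 3) → EuclideanSpace ℝ (Fin 3)}
    (hdss : IsDiscretelySelfSimilar c u) {T : ℝ}
    (hzero : ∀ s < T, u s =ᵐ[volume] 0) : ∀ t < 0, u t =ᵐ[volume] 0 := by
  intro t ht
  have hc2 : 1 < c ^ 2 := by nlinarith
  obtain ⟨k, hk⟩ : ∃ k : ℕ, T / t < (c ^ 2) ^ k := pow_unbounded_of_one_lt (T / t) hc2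
  have hs : (c ^ k) ^ 2 * t < T := by
    rw [div_lt_iff_of_neg ht] at hk
    calc (c ^ k) ^ 2 * t = (c ^ 2) ^ k * t := by ring
      _ < T := hk
  have hck : c ^ k ≠ 0 := pow_ne_zero k (by positivity)
  have hpow := quantisedSymmetry_isDiscretelySelfSimilar_pow hdss k
  have hrepr : ∀ x, u t x = c ^ k • u ((c ^ k) ^ 2 * t) (c ^ k • x) := fun x =>
    (congrFun (congrFun hpow t) x).symm
  have hae := (Measure.quasiMeasurePreserving_smul
    (volume : Measure (EuclideanSpace ℝ (Fin 3))) hck).ae_eq_comp (hzero _ hs)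
  filter_upwards [hae] with x hx
  simp only [Function.comp_apply, Pi.zero_apply] at hx
  rw [Pi.zero_apply, hrepr x, hx, smul_zero]

/-- **`LiouvilleKillsProfile`** (route `QuantisedSymmetry`, support item
stmt-NavierStokesRegularity-1408): the polyhedral Type-I Liouville theorem
(`PolyhedralTypeILiouville`) refutes the existence of a polyhedrally equivariant Type-I `λ`-DSS
ancient mild profile (`PolyhedralDssProfileExists`). Time shift by `-1` puts the profile in the
bounded ancient class with the same Type-I constant and symmetry; the Liouville hypothesis kills it
for `t < -1`; discrete self-similarity spreads the vanishing to all `t < 0` (KNSS 2009, §1). [folklore] -/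
theorem quantisedSymmetry_liouvilleKillsProfile_proof :
    Summit.NavierStokesRegularity.NavierStokesRegularity.Theses.QuantisedSymmetry.LiouvilleKillsProfile := by
  unfold Summit.NavierStokesRegularity.NavierStokesRegularity.Theses.QuantisedSymmetry.LiouvilleKillsProfile
  rintro hL ⟨G, hfin, hdet, hirr, c, hc, u, hanc, hmeas, hdss, ⟨C₀, hdec⟩, heqv, hnt⟩
  apply hnt
  -- the time-shifted field `v t = u (t - 1)`
  set v : ℝ → EuclideanSpace ℝ (Fin 3) → EuclideanSpace ℝ (Fin 3) := fun t => u (t + (-1)) with hv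
  have hC₀ : 0 ≤ C₀ := by
    have h := hdec (-1) (by norm_num) 0
    rw [norm_zero, zero_add, neg_neg, Real.sqrt_one, div_one] at h
    exact (norm_nonneg _).trans h
  have hanc' : IsAncientMildSolution 1 v := hanc.time_translate (by norm_num)
  have hbdd' : IsBoundedOn (Iio 0) v := by
    refine ⟨C₀, fun t ht x => ?_⟩
    simp only [mem_Iio] at ht
    have ht' : t + (-1) < 0 := by linarith
    refine (hdec _ ht' x).trans (div_le_self hC₀ ?_)
    have h1 : (1 : ℝ) ≤ Real.sqrt (-(t + (-1))) :=
      calc (1 : ℝ) = Real.sqrt 1 := Real.sqrt_one.symm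
        _ ≤ Real.sqrt (-(t + (-1))) := Real.sqrt_le_sqrt (by linarith)
    linarith [norm_nonneg x]
  have hmeas' : ∀ t < 0, AEStronglyMeasurable (v t) volume := fun t ht => hmeas _ (by linarith)
  have hdec' : HasTypeIDecay C₀ v := by
    intro t ht x
    have ht' : t + (-1) < 0 := by linarith
    refine (hdec _ ht' x).trans ?_
    have hpos : 0 < ‖x‖ + Real.sqrt (-t) :=
      add_pos_of_nonneg_of_pos (norm_nonneg _) (Real.sqrt_pos.2 (by linarith))
    have hsq : Real.sqrt (-t) ≤ Real.sqrt (-(t + (-1))) := Real.sqrt_le_sqrt (by linarith)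
    exact div_le_div_of_nonneg_left hC₀ hpos (add_le_add le_rfl hsq)
  have heqv' : ∀ g ∈ G, ∀ t x, v t (g x) = g (v t x) := fun g hg t x => heqv g hg _ x
  have hzero : ∀ t < 0, v t =ᵐ[volume] 0 :=
    hL G hfin hdet hirr v ⟨hanc', hbdd'⟩ hmeas' ⟨C₀, hdec'⟩ heqv'
  have hzero' : ∀ s < (-1 : ℝ), u s =ᵐ[volume] 0 := by
    intro s hs
    have h := hzero (s + 1) (by linarith)
    have hvs : v (s + 1) = u s := by
      simp only [hv]
      rw [show s + 1 + (-1) = s by ring]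
    rwa [hvs] at h
  exact quantisedSymmetry_ae_zero_of_dss hc hdss hzero'

end Summit.NavierStokesRegularity.NavierStokesRegularity.Theorems
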